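import Summits.BirchSwinnertonDyer.BirchSwinnertonDyer.Theorems.EisensteinPrimesLineWeilRelation
import Summits.BirchSwinnertonDyer.BirchSwinnertonDyer.Theorems.EisensteinPrimesMazurMCOnCellBTwistbackTwistLineCharactersPackage
import Summits.BirchSwinnertonDyer.BirchSwinnertonDyer.Theorems.EisensteinPrimesMazurMCOnCellBTwistbackTwistLocalBalance
import Summits.BirchSwinnertonDyer.BirchSwinnertonDyer.Theorems.EisensteinPrimesMazurMCOnCellBTwistbackKLFlatPartnerUnitsPsi
import Summits.BirchSwinnertonDyer.BirchSwinnertonDyer.Theorems.EisensteinPrimesMazurMCOnCellBTwistbackPartnerClassNumberLift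
import Summits.BirchSwinnertonDyer.BirchSwinnertonDyer.Theorems.GenusKolyvaginAtTwoGenusPrimitiveSupplyAtTwoHeegnerTwinTamagawaOdd
import Summits.BirchSwinnertonDyer.Rank1Residual.X2.RankOneNonsplitTransfer
import Literature.NumberTheory.EllipticCurves.IsogenyIdProofs
import Literature.NumberTheory.EllipticCurves.HeegnerHypothesisKroneckerProofs
import Literature.NumberTheory.EllipticCurves.HeegnerPointsImaginaryQuadraticProofs
import Literature.NumberTheory.EllipticCurves.LFunctionPrimeCoeff
import Literature.NumberTheory.QuadraticFields.FundamentalDiscriminant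
import Literature.NumberTheory.EllipticCurves.Monsky1990.GenusFieldGaloisData
import HarnessLib

/-!
# Crux 3 `MazurMCOnCellB` (stmt-BirchSwinnertonDyer-19033), line `twistback` v4 — the SUB-ROW ASSEMBLY, part 1:
# the KL-FLAT CARRIER of the twist `E^{(d_K)}` CONSTRUCTED in the kernel from the line datum of `E` and the
# class number `p ∤ h(ℚ(√(d_ψ·d_K)))` — the binder `hKL` of the doors p645525 §3 / p650387 as a THEOREM
# about `(E, K)` (first X2b shape: line of `E` ramified-odd)

LEAD bsd-line-x2-p1 g11 (2026-08-28). HONEST FRAMING (cell `bsd-eis`, run/shared/lean/pub/bsd-eis/): Galois-module /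
character / local-Euler-factor bookkeeping; THEOREMS ONLY (no `def`, no named fact introduced, no `sorry`);
`--supports` stmt-BirchSwinnertonDyer-19033; closes no stub by itself; no summit statement, no Mazur main conjecture
and no BSD is proved for any curve; 0 cells / labels / tiers move.

WHAT. The doors into stub 6 (∃-PARTNER) of LEAD g10 (`…TwistbackKLFlatPartner` §3, p645525) and of width seat w5
(`…TwistbackLamOnePartner`, p650387: the partner's analytic rank DERIVED, modulo Keller–Yin Thm. E) take, for ONE
admissible `K`, the binder `hKL`: EVERY globally minimal model `Wd` of `E^{(d_K)}` has a carrier `V′` `ℚ`-isogenous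
to `Wd` with a rational line RAMIFIED at `p` and EVEN, PRIMITIVE characters `φ′` (mod `m′`, `p ∣ m′`), `ψ′` (mod
`d′`, `p ∤ d′`), a finite set `S₀′ ∌ p` off which `V′` is good, the two KL-FLAT units `‖L_∅(C,0)‖ = ‖L_∅(D,0)‖ = 1`,
and local balance `1`. The width seats typed every brick of the dictionary (w3 g8: transport of the line and its
characters to the twist, p648132/p648554; quadratic Kronecker–Weber for odd `d_K`, p649377; the local balance
transfer «c(E^K) = c(E)», p650230; w3 g6/g7: the Bernoulli unit as a class number, p643262/p645281/p645724; w7: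
`ψ′(p) = −1` at a non-split carrier, p649032/p650639; LEAD g10: the two units from ONE, p645771) and this seat the
Weil relation `hφψ` (`…LineWeilRelation`). THIS FILE COMPOSES THEM: `hKL` is a THEOREM about `(E, K)`.

* §1 `exists_finset_places_dvd` (the finite set of places dividing `n ≠ 0`), `isQuadratic_ringHomComp_int`
  (reduction mod `p` of a quadratic `ℤ`-valued character is quadratic-valued); `(2/n) = 1` for `n ≡ 7 (mod 8)` is
  the tree's `Monsky1990.jacobiSym_two_of_mod_eight_seven`.
* §2 **`exists_klFlatCarrier_twist_of_ramifiedOdd`** — FIRST X2b SHAPE. Data: `W` X2 (`p ≠ 2` multiplicative,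
  `E[p]` reducible) NON-split at `p`; a rational line `Φ₀ ≤ W[p]` RAMIFIED at `p` and ODD with PRIMITIVE characters
  `φ` (mod `m`, `p ∣ m`) and `ψ` (mod `d`, `p ∤ d`), `ψ` quadratic-valued (automatic at `p = 3`); a finite set
  `S₀ ∌ p` of places off which `W` is good away from `p`, with LOCAL BALANCE ONE
  `1 + Σ_{S₀} δ_W = Σ_{S₀} (s[φ(ℓ)=ℓ̄] + s[ψ(ℓ)=ℓ̄])` («c(E) = 1»); an imaginary quadratic `K` with `d_K ≡ 1 (mod 4)`,
  `d_K < −4`, `p` split, every `ℓ_v` (`v ∈ S₀`) dividing a level `N₀` for which `K` is Heegner, `gcd(m, d_K) =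
  gcd(d, d_K) = 1`, and the CLASS NUMBER `p ∤ h(−d·|d_K|)` (`= h(ℚ(√(d_ψ d_K)))`). Conclusion: `hKL` VERBATIM, with
  `V′ = Wd`, `S₀′ = S₀ ∪ {v ∣ d_K}`, `Φ₀′ = e⁻¹Φ₀`, `φ′ = φχ̄_K` (mod `m|d_K|`), `ψ′ = ψχ̄_K` (mod `d|d_K|`).
* (§3, sequel file `…TwistbackSubrowCarrierEven`: the SECOND shape, line unramified-even, carrier `Wd/Ψ₀`.)

References: [GreenbergVatsal2000] Thm. (1.3), §2 p. 28, Prop. (2.4), §3 (26)–(28) Thm. (3.11); [Washington1997]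
Thm. 4.17, Thm. 5.11, Ch. 3; [SilvermanAEC2009] X.5 Cor. 5.4, VII.5 Prop. 5.1, Cor. VII.7.2; [IrelandRosen1990]
Prop. 6.3.2, Prop. 20.5.4; [Cox2013] (1.17), Thm. 7.7; [KrizLi2019] §9 (the shape `h₃(D·d_K) = 1`).
-/

set_option autoImplicit false

-- `Summit.BirchSwinnertonDyer.BirchSwinnertonDyer.…`: the summit and its single sub-problem share a name.
set_option linter.dupNamespace false

noncomputable section

open scoped Classical NumberTheorySymbols

open WeierstrassCurve NumberField IsDedekindDomain Field DirichletCharacter Rat.HeightOneSpectrum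
  Literature.NumberTheory.EllipticCurves Literature.NumberTheory.GaloisRepresentations
  Literature.NumberTheory.EllipticCurves.Rank1Residual Literature.NumberTheory.EllipticCurves.GreenbergVatsal2000
  Literature.NumberTheory.QuadraticFields
  Summit.BirchSwinnertonDyer.Rank1Residual Summit.BirchSwinnertonDyer.Rank1Residual.X2
  Summit.BirchSwinnertonDyer.BirchSwinnertonDyer.Theorems.EisensteinPrimesLineWeilRelation
  Summit.BirchSwinnertonDyer.BirchSwinnertonDyer.Theorems.EisensteinPrimesMazurMCOnCellBTwistbackTwistLineCharacters
  Summit.BirchSwinnertonDyer.BirchSwinnertonDyer.Theorems.EisensteinPrimesMazurMCOnCellBTwistbackTwistLineCharactersPackage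
  Summit.BirchSwinnertonDyer.BirchSwinnertonDyer.Theorems.EisensteinPrimesMazurMCOnCellBTwistbackTwistLocalBalance
  Summit.BirchSwinnertonDyer.BirchSwinnertonDyer.Theorems.EisensteinPrimesMazurMCOnCellBTwistbackQuadraticRadical
  Summit.BirchSwinnertonDyer.BirchSwinnertonDyer.Theorems.EisensteinPrimesMazurMCOnCellBTwistbackKLFlatPartnerUnits
  Summit.BirchSwinnertonDyer.BirchSwinnertonDyer.Theorems.EisensteinPrimesMazurMCOnCellBTwistbackPartnerClassNumberLift
  Summit.BirchSwinnertonDyer.BirchSwinnertonDyer.Theorems.EisensteinPrimesLinePsiAtMultiplicativePrime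

namespace Summit.BirchSwinnertonDyer.BirchSwinnertonDyer.Theorems.EisensteinPrimesMazurMCOnCellBTwistbackSubrowCarrier

/-! ## §1. Two small helpers -/

/-- **The finite set of places of `ℚ` dividing `n ≠ 0`** (the primes of `n` through Mathlib's `primesEquiv`).
[folklore] -/
theorem exists_finset_places_dvd (n : ℕ) (hn : n ≠ 0) :
    ∃ T : Finset (HeightOneSpectrum (𝓞 ℚ)), ∀ v, v ∈ T ↔ natGenerator v ∣ n := by
  refine ⟨(Finset.univ : Finset {q // q ∈ n.primeFactors}).image
      (fun q ↦ (primesEquiv (R := 𝓞 ℚ)).symm ⟨q.1, Nat.prime_of_mem_primeFactors q.2⟩), fun v ↦ ⟨?_, ?_⟩⟩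
  · intro hv
    obtain ⟨q, -, hq⟩ := Finset.mem_image.mp hv
    have h : natGenerator v = q.1 := by
      rw [← hq]
      exact congrArg (fun x : Nat.Primes ↦ (x : ℕ)) ((primesEquiv (R := 𝓞 ℚ)).apply_symm_apply _)
    rw [h]
    exact Nat.dvd_of_mem_primeFactors q.2
  · intro hv
    refine Finset.mem_image.mpr ⟨⟨natGenerator v, Nat.mem_primeFactors.mpr ⟨prime_natGenerator v, hv, hn⟩⟩,
      Finset.mem_univ _, ?_⟩
    exact (primesEquiv (R := 𝓞 ℚ)).symm_apply_apply v

/-- Reduction modulo `p` of a quadratic `ℤ`-valued character is quadratic-valued. [folklore] -/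
theorem isQuadratic_ringHomComp_int {N p : ℕ} {χ : MulChar (ZMod N) ℤ} (hχ : χ.IsQuadratic) :
    (χ.ringHomComp (Int.castRingHom (ZMod p)) : DirichletCharacter (ZMod p) N).IsQuadratic := by
  intro a
  rw [MulChar.ringHomComp_apply]
  rcases hχ a with h | h | h <;> simp [h]

/-! ## §2. First X2b shape: line RAMIFIED-ODD — the carrier is the twist itself -/

/-- **The KL-flat carrier of the twist, CONSTRUCTED (first X2b shape).** For `W/ℚ` globally minimal X2 at `p`
(`p ≠ 2` multiplicative, `E[p]` reducible) and NON-split at `p`; a rational line `Φ₀ ≤ W[p]` RAMIFIED at `p` and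
ODD (Greenberg–Vatsal parity fails) with PRIMITIVE characters `φ` (mod `m`, `p ∣ m`) on `Φ₀` and `ψ` (mod `d`,
`p ∤ d`) on `W[p]/Φ₀`, `ψ` quadratic-valued; a finite set of places `S₀ ∌ p` with `W` good off `S₀ ∪ {p}` and LOCAL
BALANCE ONE over `S₀`; an imaginary quadratic `K`, `d_K ≡ 1 (mod 4)`, `d_K < −4`, `p` split in `K`, `K` Heegner for
a level `N₀` divisible by every `ℓ_v`, `v ∈ S₀`, `gcd(m, d_K) = gcd(d, d_K) = 1`, and `p ∤ h(−d·|d_K|)`: EVERY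
globally minimal model `Wd` of `W^{(d_K)}` carries the door's KL-flat datum — `V′ = Wd`, the line `e⁻¹Φ₀` (RAMIFIED,
EVEN: the odd twist unramified at `p` swaps the parity), characters `φχ̄_K` (mod `m|d_K|`), `ψχ̄_K` (mod `d|d_K|`)
(w3 g8), `S₀′ = S₀ ∪ {v ∣ d_K}`, the two units from the Weil relation (`…LineWeilRelation`), `ψ′(p) = −1` (w7) and
`‖B₁(ω̃∘ψ′⁻¹)‖_p = ‖h(−d|d_K|)‖_p` (w3 g7), and balance `1` by «c(E^K) = c(E)» (w3 g8 part 4: `δ` and the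
indicators agree on `S₀` — split places —, vanish on the primes of `d_K`). VERBATIM the binder `hKL` of p645525 §3 /
p650387. [cite: GreenbergVatsal2000, Thm. (1.3), §2 p. 28 and Prop. (2.4), §3 (26)–(28)]
[cite: SilvermanAEC2009, X.5 Cor. 5.4 and VII.5 Prop. 5.1] [cite: Washington1997, Thm. 4.17 and Thm. 5.11]
[cite: IrelandRosen1990, Ch. 20 §5 Prop. 20.5.4 and Ch. 6 Prop. 6.3.2] [cite: Cox2013, §1.C (1.17) and Thm. 7.7 (ii)] -/
theorem exists_klFlatCarrier_twist_of_ramifiedOdd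
    (W : WeierstrassCurve ℚ) [W.IsElliptic] [W.IsGloballyMinimal] (p : ℕ) [Fact p.Prime]
    (hX : ClassX2 W p) (hns : ¬ W.HasSplitMultiplicativeReductionAtPrime p)
    {Φ₀ : AddSubgroup (geomTorsion W (p : ℤ))} (hΦ : IsRationalLine W p Φ₀)
    (hram : ¬ LineUnramifiedAt W p Φ₀) (hodd : LineOdd W p Φ₀)
    {m : ℕ} [NeZero m] (φ : DirichletCharacter (ZMod p) m) {d : ℕ} [NeZero d]
    (ψ : DirichletCharacter (ZMod p) d) (hφ : φ.IsPrimitive) (hψ : ψ.IsPrimitive) (hpm : p ∣ m)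
    (hpd : ¬ p ∣ d) (hquad : ψ.IsQuadratic)
    (hφ0 : ∀ (σ : absoluteGaloisGroup ℚ), ∀ P ∈ Φ₀,
      σ • P = (φ ((modNCyclotomicCharacter ℚ m σ : (ZMod m)ˣ) : ZMod m)).val • P)
    (hψ0 : ∀ (σ : absoluteGaloisGroup ℚ) (P : geomTorsion W (p : ℤ)),
      σ • P - (ψ ((modNCyclotomicCharacter ℚ d σ : (ZMod d)ˣ) : ZMod d)).val • P ∈ Φ₀)
    (S₀ : Finset (HeightOneSpectrum (𝓞 ℚ))) (hS₀p : ∀ v ∈ S₀, ((p : ℕ) : 𝓞 ℚ) ∉ v.asIdeal)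
    (hS : ∀ v : HeightOneSpectrum (𝓞 ℚ), v ∉ S₀ → ((p : ℕ) : 𝓞 ℚ) ∉ v.asIdeal → W.HasGoodReductionAt v)
    (hbal : 1 + ∑ v ∈ S₀, delta W p v =
      ∑ v ∈ S₀, ((if φ (Rat.HeightOneSpectrum.natGenerator v : ZMod m) =
            (Rat.HeightOneSpectrum.natGenerator v : ZMod p)
          then sFactor p (Rat.HeightOneSpectrum.natGenerator v) else 0) +
        (if ψ (Rat.HeightOneSpectrum.natGenerator v : ZMod d) =
            (Rat.HeightOneSpectrum.natGenerator v : ZMod p)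
          then sFactor p (Rat.HeightOneSpectrum.natGenerator v) else 0)))
    (K : Type) [Field K] [NumberField K] (hK : IsImaginaryQuadratic K)
    (hHp : SatisfiesHeegnerHypothesis p K) (hK4 : NumberField.discr K % 4 = 1) (hlt : NumberField.discr K < -4)
    {N₀ : ℕ} (hHN₀ : SatisfiesHeegnerHypothesis N₀ K)
    (hS₀N₀ : ∀ v ∈ S₀, Rat.HeightOneSpectrum.natGenerator v ∣ N₀)
    (hmK : m.Coprime (NumberField.discr K).natAbs) (hdK : d.Coprime (NumberField.discr K).natAbs)
    (hh : ¬ p ∣ BinaryQuadraticForm.classNumber (-((d * (NumberField.discr K).natAbs : ℕ) : ℤ))) :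
    ∀ (Wd : WeierstrassCurve ℚ) [Wd.IsElliptic] [Wd.IsGloballyMinimal],
      (∃ C : VariableChange ℚ, C • Wd = W.quadraticTwist (NumberField.discr K : ℚ)) →
      ∃ (V' : WeierstrassCurve ℚ) (_ : V'.IsElliptic) (_ : V'.IsGloballyMinimal), IsIsogenous Wd V' ∧
        ∃ (S₀' : Finset (HeightOneSpectrum (𝓞 ℚ))) (Φ₀' : AddSubgroup (V'.geomTorsion (p : ℤ)))
          (m' : ℕ) (_ : NeZero m') (φ' : DirichletCharacter (ZMod p) m')
          (d' : ℕ) (_ : NeZero d') (ψ' : DirichletCharacter (ZMod p) d'),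
          IsRationalLine V' p Φ₀' ∧ ¬ LineUnramifiedAt V' p Φ₀' ∧ LineEven V' p Φ₀' ∧
          φ'.IsPrimitive ∧ ψ'.IsPrimitive ∧ p ∣ m' ∧ ¬ p ∣ d' ∧
          (∀ (σ : absoluteGaloisGroup ℚ), ∀ Q ∈ Φ₀',
            σ • Q = (φ' ((modNCyclotomicCharacter ℚ m' σ : (ZMod m')ˣ) : ZMod m')).val • Q) ∧
          (∀ (σ : absoluteGaloisGroup ℚ) (Q : V'.geomTorsion (p : ℤ)),
            σ • Q - (ψ' ((modNCyclotomicCharacter ℚ d' σ : (ZMod d')ˣ) : ZMod d')).val • Q ∈ Φ₀') ∧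
          (∀ v ∈ S₀', ((p : ℕ) : 𝓞 ℚ) ∉ v.asIdeal) ∧
          (∀ v : HeightOneSpectrum (𝓞 ℚ), v ∉ S₀' → ((p : ℕ) : 𝓞 ℚ) ∉ v.asIdeal →
            V'.HasGoodReductionAt v) ∧
          ‖characterLValueC p φ' ∅ 1‖ = 1 ∧ ‖characterLValueD p ψ' ∅ 1‖ = 1 ∧
          1 + ∑ v ∈ S₀', delta V' p v =
            ∑ v ∈ S₀', ((if φ' (Rat.HeightOneSpectrum.natGenerator v : ZMod m') =
                  (Rat.HeightOneSpectrum.natGenerator v : ZMod p)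
                then sFactor p (Rat.HeightOneSpectrum.natGenerator v) else 0) +
              (if ψ' (Rat.HeightOneSpectrum.natGenerator v : ZMod d') =
                  (Rat.HeightOneSpectrum.natGenerator v : ZMod p)
                then sFactor p (Rat.HeightOneSpectrum.natGenerator v) else 0)) := by
  intro Wd _ _ hWd
  obtain ⟨C, hC⟩ := hWd
  have hp : p.Prime := Fact.out
  haveI : NeZero p := ⟨hp.ne_zero⟩
  have hp2 : p ≠ 2 := hX.1
  have hmult : W.HasMultiplicativeReductionAtPrime p := hX.2.2
  have h2 : Module.finrank ℚ K = 2 := hK.1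
  have hD0 : NumberField.discr K < 0 := hK.discr_neg
  have hpD : ¬ (p : ℤ) ∣ NumberField.discr K := not_dvd_discr_of_split hK hp hp2 hHp
  -- `N = |d_K|`, odd, squarefree, `> 4`, prime to `p`
  set N : ℕ := (NumberField.discr K).natAbs with hNdef
  have hNZ : (N : ℤ) = -NumberField.discr K := Int.ofNat_natAbs_of_nonpos hD0.le
  have hN0 : N ≠ 0 := Int.natAbs_ne_zero.mpr (NumberField.discr_ne_zero K)
  haveI : NeZero N := ⟨hN0⟩
  have hN4 : 4 < N := by omega
  have hpN : ¬ p ∣ N := fun h ↦ by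
    rw [← Int.natCast_dvd_natCast, hNZ, dvd_neg] at h
    exact hpD h
  have hsq : Squarefree N := by
    rcases Quadratic.isFundamentalDiscriminant_discr (K := K) h2 with ⟨-, hsf, -⟩ | ⟨h4, -, -⟩
    · exact Int.squarefree_natAbs.mpr hsf
    · exfalso; omega
  -- the quadratic character `χ = (·/|d_K|)` of `K` (quadratic Kronecker–Weber, w3 g8 part 3)
  obtain ⟨χ, hχ2, hχp, hχJ, hχτ⟩ := exists_quadraticChar_geomSqrt_of_emod_four (p := p) hp2 hK4 hsq
  -- the twisted line on `Wd` with its primitive characters (w3 g8 part 2, first shape)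
  obtain ⟨Ψ₀, hΨ, hΨram, hΨeven, hprimφ', hprimψ', hpm', hpd', hφ'0, hψ'0⟩ :=
    exists_twistLine_ramifiedEven_characters (W := W) (Wd := Wd) hp2 hD0 hpD χ hχ2 hχτ hχp hΦ hram hodd φ ψ hφ
      hψ hpm hpd hmK hdK hφ0 hψ0 C hC
  set φ' : DirichletCharacter (ZMod p) (m * N) :=
    changeLevel (dvd_mul_right m N) φ * changeLevel (dvd_mul_left N m) (χ.ringHomComp (Int.castRingHom (ZMod p)))
    with hφ'def
  set ψ' : DirichletCharacter (ZMod p) (d * N) :=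
    changeLevel (dvd_mul_right d N) ψ * changeLevel (dvd_mul_left N d) (χ.ringHomComp (Int.castRingHom (ZMod p)))
    with hψ'def
  -- the places of `d_K`
  obtain ⟨T, hT⟩ := exists_finset_places_dvd N hN0
  have hTdvd : ∀ v ∈ T, ((Rat.HeightOneSpectrum.natGenerator v : ℕ) : ℤ) ∣ NumberField.discr K := fun v hv ↦ by
    have h := (hT v).mp hv
    rw [← Int.natCast_dvd_natCast, hNZ, dvd_neg] at h
    exact h
  have hTp : ∀ v ∈ T, Rat.HeightOneSpectrum.natGenerator v ≠ p := fun v hv h ↦ hpN (h ▸ (hT v).mp hv)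
  have hS₀T : ∀ v ∈ S₀, v ∉ T := fun v hv hvT ↦
    Literature.SatisfiesHeegnerHypothesis.not_dvd_discr h2 hHN₀ (prime_natGenerator v) (hS₀N₀ v hv) (hTdvd v hvT)
  have hST : Disjoint S₀ T := Finset.disjoint_left.mpr hS₀T
  -- places v with `(p) ∉ v` are the places with `ℓ_v ≠ p`
  have hpv : ∀ v : HeightOneSpectrum (𝓞 ℚ), ((p : ℕ) : 𝓞 ℚ) ∉ v.asIdeal ↔
      Rat.HeightOneSpectrum.natGenerator v ≠ p := fun v ↦ by
    rw [Rat.natCast_mem_asIdeal_iff v, Nat.dvd_prime hp]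
    have h1 : Rat.HeightOneSpectrum.natGenerator v ≠ 1 := (prime_natGenerator v).ne_one
    tauto
  -- the units: Weil relation on `Wd`, `ψ′(p) = −1`, the class number
  have hφψ' := weilRelation_of_line hΨ hprimφ' hprimψ' hφ'0 hψ'0
  have hψ'p : ψ' (p : ZMod (d * N)) ≠ 1 :=
    (psi_natCast_ne_one_of_twist_carrier W p hp2 hmult hns K hK hHp Wd ⟨C, hC⟩ Wd Wd.isIsogenous_self hΨ hΨram
      ψ' hpd' hψ'0).2
  have hquad' : ψ'.IsQuadratic := isQuadratic_changeLevel_mul_changeLevel hquad (isQuadratic_ringHomComp_int hχ2)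
  have hodd' : ψ'.Odd := odd_quot_of_lineEven hΨ hΨeven hφ'0 hψ'0
  have h4 : 4 < d * N := lt_of_lt_of_le hN4 (Nat.le_mul_of_pos_left N (Nat.pos_of_ne_zero (NeZero.ne d)))
  have hB : ‖twistedBernoulli p 1 (d * N) (fun a : ℕ ↦ teichmullerLift p (ψ' (a : ZMod (d * N)))⁻¹)‖ = 1 :=
    (norm_twistedBernoulli_teichmullerLift_inv_eq_one_iff_of_isPrimitive p hp2 h4 ψ' hquad' hprimψ' hodd').mpr hh
  obtain ⟨hC1, hD1⟩ := klFlat_of_norm_twistedBernoulli_eq_one p φ' ψ' hp2 hφψ' hψ'p hB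
  -- good reduction of `Wd` off `S₀ ∪ T ∪ {p}`
  have hC' : C⁻¹ • W.quadraticTwist (NumberField.discr K : ℚ) = Wd := by rw [← hC, inv_smul_smul]
  have hgoodWd : ∀ v : HeightOneSpectrum (𝓞 ℚ), v ∉ S₀ ∪ T → ((p : ℕ) : 𝓞 ℚ) ∉ v.asIdeal →
      Wd.HasGoodReductionAt v := by
    intro v hv hvp
    rw [Finset.mem_union, not_or] at hv
    have hW : W.HasGoodReductionAt v := hS v hv.1 hvp
    haveI : Fact (Rat.HeightOneSpectrum.natGenerator v).Prime := ⟨prime_natGenerator v⟩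
    have hW' : W.HasGoodReductionAtPrime (Rat.HeightOneSpectrum.natGenerator v) :=
      (hasGoodReductionAtPrime_iff_hasGoodReductionAt_ringOfIntegers W (v := v)).mpr hW
    have hℓD : ¬ ((Rat.HeightOneSpectrum.natGenerator v : ℕ) : ℤ) ∣ NumberField.discr K := by
      intro h
      apply hv.2
      rw [hT, ← Int.natCast_dvd_natCast, hNZ]
      exact dvd_neg.mpr h
    have hWd' := GenusKolyTwin.hasGoodReductionAtPrime_twist_of_not_dvd W hK4 C⁻¹ hC'
      (Rat.HeightOneSpectrum.natGenerator v) hW' hℓD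
    exact (hasGoodReductionAtPrime_iff_hasGoodReductionAt_ringOfIntegers Wd (v := v)).mp hWd'
  -- the balance transfer «c(E^K) = c(E)»
  have hδS : ∀ v ∈ S₀, delta Wd p v = delta W p v := fun v hv ↦
    delta_twist_eq_of_heegner W K p h2 hHN₀ v (hS₀N₀ v hv) C hC
  have hδT : ∀ v ∈ T, delta Wd p v = 0 := fun v hv ↦
    delta_twist_eq_zero_of_dvd_discr W K p h2 v (hTdvd v hv)
      (hS v (fun hvS ↦ hS₀T v hvS hv) ((hpv v).mpr (hTp v hv))) C hC
  have hχ1 : ∀ v ∈ S₀, χ (Rat.HeightOneSpectrum.natGenerator v : ZMod N) = 1 := by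
    intro v hv
    by_cases h2v : Rat.HeightOneSpectrum.natGenerator v = 2
    · have h8 : NumberField.discr K % 8 = 1 :=
        Literature.SatisfiesHeegnerHypothesis.discr_emod_eight h2 hHN₀ (h2v ▸ hS₀N₀ v hv)
      rw [hχJ, h2v]
      exact Monsky1990.jacobiSym_two_of_mod_eight_seven (by omega)
    · exact chi_natCast_eq_one_of_heegner h2 hK4 hHN₀ χ hχJ (prime_natGenerator v) h2v (hS₀N₀ v hv)
  have hφS : ∀ v ∈ S₀, φ' (Rat.HeightOneSpectrum.natGenerator v : ZMod (m * N)) =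
      φ (Rat.HeightOneSpectrum.natGenerator v : ZMod m) := fun v hv ↦
    twistChar_natCast_of_apply_eq_one φ χ (hχ1 v hv)
  have hψS : ∀ v ∈ S₀, ψ' (Rat.HeightOneSpectrum.natGenerator v : ZMod (d * N)) =
      ψ (Rat.HeightOneSpectrum.natGenerator v : ZMod d) := fun v hv ↦
    twistChar_natCast_of_apply_eq_one ψ χ (hχ1 v hv)
  have hncop : ∀ v ∈ T, ¬ (Rat.HeightOneSpectrum.natGenerator v).Coprime N := fun v hv h ↦
    (Nat.Prime.coprime_iff_not_dvd (prime_natGenerator v)).mp h ((hT v).mp hv)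
  have hφT : ∀ v ∈ T, φ' (Rat.HeightOneSpectrum.natGenerator v : ZMod (m * N)) = 0 := fun v hv ↦
    twistChar_natCast_of_not_coprime φ χ (hncop v hv)
  have hψT : ∀ v ∈ T, ψ' (Rat.HeightOneSpectrum.natGenerator v : ZMod (d * N)) = 0 := fun v hv ↦
    twistChar_natCast_of_not_coprime ψ χ (hncop v hv)
  have hTp' : ∀ v ∈ T, (Rat.HeightOneSpectrum.natGenerator v : ZMod p) ≠ 0 := fun v hv h ↦ by
    rw [ZMod.natCast_eq_zero_iff, Nat.dvd_prime (prime_natGenerator v)] at h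
    rcases h with h | h
    · exact hp.ne_one h
    · exact hTp v hv h.symm
  have hbal' := (balance_union_iff (W := W) (Wd := Wd) φ ψ φ' ψ' S₀ T hST hδS hδT hφS hψS hφT hψT hTp' 1).mpr hbal
  -- assemble
  refine ⟨Wd, ‹_›, ‹_›, Wd.isIsogenous_self, S₀ ∪ T, Ψ₀, m * N, inferInstance, φ', d * N, inferInstance, ψ',
    hΨ, hΨram, hΨeven, hprimφ', hprimψ', hpm', hpd', hφ'0, hψ'0, ?_, hgoodWd, hC1, hD1, hbal'⟩
  intro v hv
  rcases Finset.mem_union.mp hv with hv | hv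
  · exact hS₀p v hv
  · exact (hpv v).mpr (hTp v hv)

end Summit.BirchSwinnertonDyer.BirchSwinnertonDyer.Theorems.EisensteinPrimesMazurMCOnCellBTwistbackSubrowCarrier

end
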